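import Mathlib
import Summits.AtomisticToContinuum.FouriersLaw.Theses.EmbeddedDrudeMourre
import HarnessLib

/-!
# An angle-floor inequality for two-term gradient decompositions
# (stub B1b″ of line `kinetic-polymer-gas-on-the-time-axis`, Morse–Bott step of the gradient floor (C4))
(crux `EmbeddedDrudeMourre.DrudeDissolution`, item stmt-AtomisticToContinuum-12593; `--supports` file, closes
nothing; lead c13)

WHAT. `sumSq_lincomb_ge_of_angle`: for two coordinate vectors `u, v ∈ ℝ³` whose angle is bounded away from `0`
and `π` in the form `|u·v| ≤ ρ‖u‖‖v‖` (`0 ≤ ρ`), every linear combination satisfies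
`‖a u + b v‖² ≥ (1 − ρ)(a²‖u‖² + b²‖v‖²)` (sums of squares of the three coordinates). Near the co-moving curve
`C₁ = {S₁ = A = 0}` the gradient of `Ω = −A·S₁·S₂` is `−S₂(A∇S₁ + S₁∇A) + O(AS₁)`, and `∇S₁ ∦ ∇A` there
(`sheetFn_plane_regular`), so this inequality is the algebraic half of the local Morse–Bott floor
`|∇Ω|² ≥ c·S₂²(A² + S₁²)` used in the global floor (C4) of the second-difference estimate.

HOW. `‖au+bv‖² = a²‖u‖² + b²‖v‖² + 2ab(u·v) ≥ a²‖u‖² + b²‖v‖² − 2ρ|a|‖u‖|b|‖v‖` and `2xy ≤ x² + y²`.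
-/

noncomputable section

namespace Summit.AtomisticToContinuum.FouriersLaw.Theorems.DrudeDissolution.KineticPolymerGasOnTheTimeAxis

/-- **Registered sub-goal `sumSq_lincomb_ge_of_angle`: the angle floor for two-term linear combinations in
coordinates.** If `|u₁v₁ + u₂v₂ + u₃v₃| ≤ ρ·√(u₁²+u₂²+u₃²)·√(v₁²+v₂²+v₃²)` with `0 ≤ ρ`, then for all `a b`:
`(1 − ρ)(a²(u₁²+u₂²+u₃²) + b²(v₁²+v₂²+v₃²)) ≤ (a u₁ + b v₁)² + (a u₂ + b v₂)² + (a u₃ + b v₃)²`. [folklore] -/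
theorem sumSq_lincomb_ge_of_angle :
    ∀ (u₁ u₂ u₃ v₁ v₂ v₃ ρ : ℝ), 0 ≤ ρ →
      |u₁ * v₁ + u₂ * v₂ + u₃ * v₃| ≤
        ρ * Real.sqrt (u₁ ^ 2 + u₂ ^ 2 + u₃ ^ 2) * Real.sqrt (v₁ ^ 2 + v₂ ^ 2 + v₃ ^ 2) →
      ∀ a b : ℝ,
        (1 - ρ) * (a ^ 2 * (u₁ ^ 2 + u₂ ^ 2 + u₃ ^ 2) + b ^ 2 * (v₁ ^ 2 + v₂ ^ 2 + v₃ ^ 2)) ≤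
          (a * u₁ + b * v₁) ^ 2 + (a * u₂ + b * v₂) ^ 2 + (a * u₃ + b * v₃) ^ 2 := by
  intro u₁ u₂ u₃ v₁ v₂ v₃ ρ hρ hang a b
  set U := u₁ ^ 2 + u₂ ^ 2 + u₃ ^ 2 with hU
  set V := v₁ ^ 2 + v₂ ^ 2 + v₃ ^ 2 with hV
  set P := u₁ * v₁ + u₂ * v₂ + u₃ * v₃ with hP
  have hU0 : 0 ≤ U := by rw [hU]; positivity
  have hV0 : 0 ≤ V := by rw [hV]; positivity
  -- expand the square
  have hexp : (a * u₁ + b * v₁) ^ 2 + (a * u₂ + b * v₂) ^ 2 + (a * u₃ + b * v₃) ^ 2 =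
      a ^ 2 * U + b ^ 2 * V + 2 * (a * b) * P := by rw [hU, hV, hP]; ring
  rw [hexp]
  -- `|2ab P| ≤ 2ρ (|a|√U)(|b|√V) ≤ ρ (a²U + b²V)`
  have hsU : Real.sqrt U ^ 2 = U := Real.sq_sqrt hU0
  have hsV : Real.sqrt V ^ 2 = V := Real.sq_sqrt hV0
  have hx : 0 ≤ |a| * Real.sqrt U := by positivity
  have hy : 0 ≤ |b| * Real.sqrt V := by positivity
  have hcross : |2 * (a * b) * P| ≤ ρ * (a ^ 2 * U + b ^ 2 * V) := by
    have h1 : |2 * (a * b) * P| = 2 * (|a| * |b|) * |P| := by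
      rw [abs_mul, abs_mul, abs_mul, abs_two]
    rw [h1]
    have h2 : 2 * (|a| * |b|) * |P| ≤ 2 * (|a| * |b|) * (ρ * Real.sqrt U * Real.sqrt V) :=
      mul_le_mul_of_nonneg_left hang (by positivity)
    refine h2.trans ?_
    have h3 : 2 * (|a| * Real.sqrt U) * (|b| * Real.sqrt V) ≤ (|a| * Real.sqrt U) ^ 2 + (|b| * Real.sqrt V) ^ 2 :=
      two_mul_le_add_sq _ _
    have h4 : (|a| * Real.sqrt U) ^ 2 + (|b| * Real.sqrt V) ^ 2 = a ^ 2 * U + b ^ 2 * V := by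
      rw [mul_pow, mul_pow, sq_abs, sq_abs, hsU, hsV]
    calc 2 * (|a| * |b|) * (ρ * Real.sqrt U * Real.sqrt V)
        = ρ * (2 * (|a| * Real.sqrt U) * (|b| * Real.sqrt V)) := by ring
      _ ≤ ρ * ((|a| * Real.sqrt U) ^ 2 + (|b| * Real.sqrt V) ^ 2) := mul_le_mul_of_nonneg_left h3 hρ
      _ = ρ * (a ^ 2 * U + b ^ 2 * V) := by rw [h4]
  have hlow := neg_abs_le (2 * (a * b) * P)
  nlinarith [hcross, hlow]

end Summit.AtomisticToContinuum.FouriersLaw.Theorems.DrudeDissolution.KineticPolymerGasOnTheTimeAxis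

end
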